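import Summits.QuantumAdvantage.QuantumAdvantage.Theorems.CubicForrelationNearExactIsExactTwelveLevelSixCrossCoset

/-!
# Crux `CubicForrelation.NearExactIsExact` (stmt-QuantumAdvantage-14043) — n = 12, level ≥ 6 AT `Φ = 59/64`: a single bad coset off the
  9-flat is impossible at off-flat energy `≤ 128`

Certificate seat `b2b-cforr-cert` (gen 15).  HONEST FRAMING: a lemma (standard axioms) for the level-`≥ 6` branch of "is `59/64` attained at
`n = 12`?"; finite-slice bookkeeping, NOT summit progress.

`tw15_single_bad_coset_false`: cubic `f, g`, `W_g = 64u''`, `Z = {u'' even} = x_Z ⊕ V₀` 9-flat, `e = u'' − (−1)^f` with off-flat energy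
`Σ_{x ∉ Z} e² ≤ 128`; if `e/2` is odd at some `p ∉ Z` but even off `Z ∪ (p ⊕ V₀)`, contradiction: the bad coset has `≥ 16` and `≤ 32` points
with `e/2` odd (6-flat parity, `ws_erm_round`), the CROSS-COSET localisation `tw6_cross_coset` (gen 13) makes the 3-flat parity base-free,
a covering makes it even, and Reed–Muller on the abstract flat gives `≥ 128` odd points.  Verbatim the round-1c of `tw6_off_flat_lt`, which
needed energy `< 128` only to exclude a second bad coset.

References: J. Ax (1964) / R. J. McEliece (1972); MacWilliams–Sloane (1977) Ch. 13 §3.  Everything below is proved from Mathlib and the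
tree; axioms are the standard three.
-/

set_option linter.dupNamespace false -- D-0017: single-problem summit ⇒ `QuantumAdvantage.QuantumAdvantage` by design

noncomputable section

namespace Summit.QuantumAdvantage.QuantumAdvantage.Theorems.CubicForrelation.NearExactIsExact

open Finset
open Literature.Computability.QuantumComplexity
open Literature.Computability.QuantumComplexity.BuzetChailloux (bxor zeroVec bxor_bxor_cancel_left bxor_zeroVec zeroVec_bxor bxor_comm
  bxor_self)
open Literature.Computability.QuantumComplexity.DerivativeWalsh (W)

/-! ### A single bad coset is impossible -/

/-- **One bad coset off the 9-flat is impossible** (off-flat energy `≤ 128`): if `e/2` is odd at `p ∉ Z` and even off `Z ∪ (p ⊕ V₀)`,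
contradiction (cross-coset localisation + covering + Reed–Muller on the abstract flat). [this work] -/
theorem tw15_single_bad_coset_false (f g : (Fin (6 + 6) → Bool) → Bool) (hf : IsDegLeFun 3 f) (hg : IsDegLeFun 3 g)
    (u'' : (Fin (6 + 6) → Bool) → ℤ) (hu'' : ∀ x, W (fun y => signOf (g y)) x = (2 : ℝ) ^ 6 * (u'' x : ℝ))
    (V₀ : Finset (Fin (6 + 6) → Bool)) (xZ : Fin (6 + 6) → Bool) (h0 : zeroVec ∈ V₀)
    (hadd : ∀ a ∈ V₀, ∀ b ∈ V₀, bxor a b ∈ V₀) (hcardV9 : #V₀ = 2 ^ 9)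
    (hS : (univ.filter fun x : Fin (6 + 6) → Bool => ¬ Odd (u'' x)) = V₀.image (bxor xZ))
    (hoff_le : ∑ x ∈ univ.filter (fun x => x ∉ (univ.filter fun x : Fin (6 + 6) → Bool => ¬ Odd (u'' x))),
      (u'' x - sZ (f x)) ^ 2 ≤ 128)
    (p : Fin (6 + 6) → Bool) (hp : p ∉ (univ.filter fun x : Fin (6 + 6) → Bool => ¬ Odd (u'' x)))
    (hpodd : Odd ((u'' p - sZ (f p)) / 2))
    (hsingle : ∀ z, z ∉ (univ.filter fun x : Fin (6 + 6) → Bool => ¬ Odd (u'' x)) → z ∉ V₀.image (bxor p) →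
      Even ((u'' z - sZ (f z)) / 2)) : False := by
  classical
  set Z := univ.filter (fun x : Fin (6 + 6) → Bool => ¬ Odd (u'' x)) with hZdef
  have hmemZ : ∀ x, x ∈ Z ↔ ¬ Odd (u'' x) := fun x => by simp [hZdef]
  set u : (Fin (6 + 6) → Bool) → ℤ := fun x => 4 * u'' x with hudef
  have hu : ∀ x, W (fun y => signOf (g y)) x = (2 : ℝ) ^ 4 * (u x : ℝ) := by
    intro x; rw [hu'' x]; simp only [u]; push_cast; ring
  set e : (Fin (6 + 6) → Bool) → ℤ := fun x => u'' x - sZ (f x) with hedef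
  have hFe : ∀ y, u y - 4 * sZ (f y) = 4 * e y := fun y => by simp only [u, e]; ring
  have heeven : ∀ x, x ∉ Z → Even (e x) := by
    intro x hx
    have hodd : Odd (u'' x) := not_not.1 fun h => hx ((hmemZ x).2 h)
    rcases tp_sZ_cases (f x) with hs | hs <;> simp only [e] <;> rw [hs]
    · exact Int.even_sub.2 (iff_of_false (Int.not_even_iff_odd.2 hodd) (by decide))
    · exact Int.even_sub.2 (iff_of_false (Int.not_even_iff_odd.2 hodd) (by decide))
  have hPV' : ∀ x, x ∉ Z → ∀ a ∈ V₀, bxor x a ∉ Z := fun x hx a ha => fl1_coset_out' hadd hS hx ha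

  -- flat sums of `4e = u − 4s`: `16 ∣` on 6-flats, `32 ∣` on 7-flats
  have hflat6 : ∀ (b : Fin (6 + 6) → Bool) (a : Fin 6 → Fin (6 + 6) → Bool),
      (4 : ℤ) ∣ ∑ ε : Fin 6 → Bool, e (fun j => b j ^^ decide (Odd #(univ.filter fun i => ε i && a i j))) := by
    intro b a
    have h1 := fs_flat_sum_dvd (e := 4) g u hg hu b a (by norm_num)
    obtain ⟨zf, hzf⟩ := sl_sum_sZ_flat f hf b a
    have hzf' : ∑ ε : Fin 6 → Bool, 4 * sZ (f (fun j => b j ^^ decide (Odd #(univ.filter fun i => ε i && a i j)))) = 16 * zf := by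
      rw [← mul_sum, hzf]; norm_num; ring
    have h1' : (16 : ℤ) ∣ ∑ ε : Fin 6 → Bool, u (fun j => b j ^^ decide (Odd #(univ.filter fun i => ε i && a i j))) := by
      have e16 : (2 : ℤ) ^ 4 = 16 := by norm_num
      rw [e16] at h1; exact h1
    have h2 : (16 : ℤ) ∣ ∑ ε : Fin 6 → Bool, (u (fun j => b j ^^ decide (Odd #(univ.filter fun i => ε i && a i j))) -
        4 * sZ (f (fun j => b j ^^ decide (Odd #(univ.filter fun i => ε i && a i j))))) := by
      rw [sum_sub_distrib, hzf']
      exact dvd_sub h1' (Dvd.intro _ rfl)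
    have h3 : ∑ ε : Fin 6 → Bool, (u (fun j => b j ^^ decide (Odd #(univ.filter fun i => ε i && a i j))) -
        4 * sZ (f (fun j => b j ^^ decide (Odd #(univ.filter fun i => ε i && a i j))))) =
        4 * ∑ ε : Fin 6 → Bool, e (fun j => b j ^^ decide (Odd #(univ.filter fun i => ε i && a i j))) := by
      rw [mul_sum]; exact sum_congr rfl fun ε _ => hFe _
    rw [h3] at h2
    obtain ⟨k, hk⟩ := h2
    exact ⟨k, by linarith⟩
  -- OFF-Z KILL, round 1: `4 ∣ e` off `Z`
  have hcos_out : ∀ p, p ∉ Z → ∀ b ∈ V₀.image (bxor p), b ∉ Z := by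
    intro p hp b hb
    obtain ⟨v, hv, rfl⟩ := mem_image.1 hb
    exact hPV' p hp v hv
  have hoff_count : ∀ (T : Finset (Fin (6 + 6) → Bool)) (c : ℤ), (∀ x ∈ T, x ∉ Z) → (∀ x ∈ T, c ≤ e x ^ 2) →
      c * #T ≤ 128 := by
    intro T c hT hc
    calc c * #T = ∑ x ∈ T, c := by rw [sum_const, nsmul_eq_mul, mul_comm]
      _ ≤ ∑ x ∈ T, e x ^ 2 := sum_le_sum hc
      _ ≤ ∑ x ∈ univ.filter (fun x => x ∉ Z), e x ^ 2 :=
          sum_le_sum_of_subset_of_nonneg (fun x hx => mem_filter.2 ⟨mem_univ _, hT x hx⟩) fun x _ _ => sq_nonneg _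
      _ ≤ 128 := hoff_le
  have hxZ : xZ ∈ Z := by rw [hS]; exact mem_image.2 ⟨zeroVec, h0, bxor_zeroVec xZ⟩
  have hPV : ∀ x, x ∈ Z → ∀ a ∈ V₀, bxor x a ∈ Z := fun x hx a ha => fl1_coset_vadd hadd hS hx ha
  have hp2 : ∀ y, y ∉ Z → e y = 2 * (e y / 2) := fun y hy =>
    (Int.mul_ediv_cancel' (even_iff_two_dvd.1 (heeven y hy))).symm
  have hcost4 : ∀ x, x ∉ Z → Odd (e x / 2) → 4 ≤ e x ^ 2 := by
    intro x hx hodd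
    have h0' := Int.odd_iff.1 hodd
    have h2 := hp2 x hx
    have : e x ≤ -2 ∨ 2 ≤ e x := by omega
    have := tp_sq_ge (k := 2) (by norm_num) this
    linarith
  -- round 1a: in a coset `p ⊕ V₀` (`p ∉ Z`) `e/2` is even, or odd at `≥ 16` points (6-flat parity + Reed–Muller on the abstract flat)
  have hdich : ∀ p, p ∉ Z → (∀ x ∈ V₀.image (bxor p), Even (e x / 2)) ∨
      16 ≤ #((V₀.image (bxor p)).filter fun x => Odd (e x / 2)) := by
    intro p hp
    rcases ws_erm_round V₀ h0 hadd hcardV9 p (fun y => e y / 2) 5 (fun b hb a ha => by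
        have hpts : ∀ ε : Fin (5 + 1) → Bool, (fun j => b j ^^ decide (Odd #(univ.filter fun i => ε i && a i j))) ∉ Z :=
          fun ε => ws_flatPt_mem V₀ h0 (· ∉ Z) hPV' (5 + 1) b (hcos_out p hp b hb) a ha ε
        have h4 := hflat6 b a
        rw [sum_congr rfl fun ε _ => hp2 _ (hpts ε), ← mul_sum] at h4
        obtain ⟨k, hk⟩ := h4
        exact ⟨k, by linarith⟩) with hev | hbig
    · exact Or.inl hev
    · right; norm_num at hbig; omega
  have hbad_of_odd : ∀ p, p ∉ Z → Odd (e p / 2) → 16 ≤ #((V₀.image (bxor p)).filter fun x => Odd (e x / 2)) := by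
    intro p hp hpodd
    refine (hdich p hp).resolve_left fun h => ?_
    exact (Int.not_even_iff_odd.2 hpodd) (h p (mem_image.2 ⟨zeroVec, h0, bxor_zeroVec p⟩))
  change Odd (e p / 2) at hpodd
  change ∀ z, z ∉ Z → z ∉ V₀.image (bxor p) → Even (e z / 2) at hsingle
  have hbad := hbad_of_odd p hp hpodd
  have hbad_le : #((V₀.image (bxor p)).filter fun x => Odd (e x / 2)) ≤ 32 := by
    have h := hoff_count ((V₀.image (bxor p)).filter fun x => Odd (e x / 2)) 4
      (fun x hx => hcos_out p hp x (mem_filter.1 hx).1)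
      (fun x hx => hcost4 x (hcos_out p hp x (mem_filter.1 hx).1) (mem_filter.1 hx).2)
    have : (#((V₀.image (bxor p)).filter fun x => Odd (e x / 2)) : ℤ) ≤ 32 := by linarith
    exact_mod_cast this
  have hout4 : ∀ y, y ∈ V₀.image (bxor p) → ∀ z, z ∉ Z → bxor z (bxor xZ y) ∉ Z → (4 : ℤ) ∣ e z := by
    intro y hy z hz hzw
    have hzC : z ∉ V₀.image (bxor p) := by
      intro hzC
      apply hzw
      obtain ⟨v, hv, rfl⟩ := mem_image.1 hzC
      obtain ⟨v', hv', rfl⟩ := mem_image.1 hy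
      have e2 : bxor (bxor p v) (bxor xZ (bxor p v')) = bxor xZ (bxor v v') := by
        funext j; simp only [bxor]; cases p j <;> cases v j <;> cases xZ j <;> cases v' j <;> rfl
      rw [e2]; exact hPV _ hxZ _ (hadd v hv v' hv')
    obtain ⟨k, hk⟩ := hsingle z hz hzC
    exact ⟨k, by rw [hp2 z hz, hk]; ring⟩
  -- the 3-flat parity `N(y)` is constant mod 2 over the bad coset
  have hkey : ∀ y, y ∈ V₀.image (bxor p) → ∀ a : Fin 3 → Fin (6 + 6) → Bool, (∀ i, a i ∈ V₀) →
      (4 : ℤ) ∣ ∑ ε : Fin 3 → Bool, e (fun j => xZ j ^^ decide (Odd #(univ.filter fun i => ε i && a i j))) +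
        2 * #((univ : Finset (Fin 3 → Bool)).filter fun ε =>
          Odd (e (fun j => y j ^^ decide (Odd #(univ.filter fun i => ε i && a i j))) / 2)) := by
    intro y hy a ha
    have ea : a = ![a 0, a 1, a 2] := by funext i; fin_cases i <;> rfl
    have h := tw6_cross_coset f g hf hg u'' hu'' V₀ xZ h0 hadd hcardV9 hS y (hcos_out p hp y hy) (hout4 y hy) (ha 0) (ha 1) (ha 2)
    rw [← ea] at h
    -- `Σ_{y-flat} e ≡ 2·N(y) (mod 4)`
    have hpts : ∀ ε : Fin 3 → Bool, (fun j => y j ^^ decide (Odd #(univ.filter fun i => ε i && a i j))) ∉ Z :=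
      fun ε => ws_flatPt_mem V₀ h0 (· ∉ Z) hPV' 3 y (hcos_out p hp y hy) a ha ε
    have hterm : ∀ ε : Fin 3 → Bool, (4 : ℤ) ∣ e (fun j => y j ^^ decide (Odd #(univ.filter fun i => ε i && a i j))) -
        2 * (if Odd (e (fun j => y j ^^ decide (Odd #(univ.filter fun i => ε i && a i j))) / 2) then 1 else 0) := by
      intro ε
      have h2 := hp2 _ (hpts ε)
      by_cases ho : Odd (e (fun j => y j ^^ decide (Odd #(univ.filter fun i => ε i && a i j))) / 2)
      · rw [if_pos ho]; have := Int.odd_iff.1 ho; omega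
      · rw [if_neg ho]; have := Int.even_iff.1 (Int.not_odd_iff_even.1 ho); omega
    have hsum4 : (4 : ℤ) ∣ ∑ ε : Fin 3 → Bool, (e (fun j => y j ^^ decide (Odd #(univ.filter fun i => ε i && a i j))) -
        2 * (if Odd (e (fun j => y j ^^ decide (Odd #(univ.filter fun i => ε i && a i j))) / 2) then 1 else 0)) :=
      dvd_sum fun ε _ => hterm ε
    rw [sum_sub_distrib, ← mul_sum, sum_boole] at hsum4
    push_cast at hsum4
    obtain ⟨k1, hk1⟩ := h
    obtain ⟨k2, hk2⟩ := hsum4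
    exact ⟨k1 - k2, by linarith⟩
  have hpar : ∀ y, y ∈ V₀.image (bxor p) → ∀ y', y' ∈ V₀.image (bxor p) → ∀ a : Fin 3 → Fin (6 + 6) → Bool, (∀ i, a i ∈ V₀) →
      (Even #((univ : Finset (Fin 3 → Bool)).filter fun ε =>
          Odd (e (fun j => y j ^^ decide (Odd #(univ.filter fun i => ε i && a i j))) / 2)) ↔
       Even #((univ : Finset (Fin 3 → Bool)).filter fun ε =>
          Odd (e (fun j => y' j ^^ decide (Odd #(univ.filter fun i => ε i && a i j))) / 2))) := by
    intro y hy y' hy' a ha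
    obtain ⟨k1, hk1⟩ := hkey y hy a ha
    obtain ⟨k2, hk2⟩ := hkey y' hy' a ha
    rw [Nat.even_iff, Nat.even_iff]
    omega
  -- if odd somewhere, the coset is covered by 8 translates of the bad set: `512 ≤ 8·31`
  have heven3 : ∀ y, y ∈ V₀.image (bxor p) → ∀ a : Fin 3 → Fin (6 + 6) → Bool, (∀ i, a i ∈ V₀) →
      Even #((univ : Finset (Fin 3 → Bool)).filter fun ε =>
          Odd (e (fun j => y j ^^ decide (Odd #(univ.filter fun i => ε i && a i j))) / 2)) := by
    intro y hy a ha
    by_contra hodd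
    have hall : ∀ y', y' ∈ V₀.image (bxor p) → ∃ ε : Fin 3 → Bool,
        Odd (e (fun j => y' j ^^ decide (Odd #(univ.filter fun i => ε i && a i j))) / 2) := by
      intro y' hy'
      have hodd' : ¬ Even #((univ : Finset (Fin 3 → Bool)).filter fun ε =>
          Odd (e (fun j => y' j ^^ decide (Odd #(univ.filter fun i => ε i && a i j))) / 2)) :=
        fun h' => hodd ((hpar y hy y' hy' a ha).2 h')
      by_contra hnone
      push Not at hnone
      apply hodd'
      rw [filter_false_of_mem (fun ε _ => hnone ε), card_empty]
      exact ⟨0, rfl⟩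
    have hv : ∀ ε : Fin 3 → Bool, (fun j => zeroVec j ^^ decide (Odd #(univ.filter fun i => ε i && a i j))) ∈ V₀ :=
      fun ε => ws_flatPt_mem V₀ h0 (· ∈ V₀) (fun x hx b hb' => hadd x hx b hb') 3 zeroVec h0 a ha ε
    have hcover : V₀.image (bxor p) ⊆ (univ : Finset (Fin 3 → Bool)).biUnion (fun ε => (V₀.image (bxor p)).filter fun y' =>
        Odd (e (bxor y' (fun j => zeroVec j ^^ decide (Odd #(univ.filter fun i => ε i && a i j)))) / 2)) := by
      intro y' hy'
      obtain ⟨ε, hε⟩ := hall y' hy'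
      rw [ws_flatPt_eq_bxor] at hε
      exact mem_biUnion.2 ⟨ε, mem_univ _, mem_filter.2 ⟨hy', hε⟩⟩
    have hcard := (card_le_card hcover).trans card_biUnion_le
    rw [sum_congr rfl fun ε _ => ws_card_translate V₀ (V₀.image (bxor p)) p hadd rfl (hv ε) (fun y' => Odd (e y' / 2)),
      sum_const, card_univ, Fintype.card_fun, Fintype.card_bool, Fintype.card_fin, smul_eq_mul] at hcard
    have hC : #(V₀.image (bxor p)) = 512 := by
      rw [card_image_of_injective _ (fun a b h => by simpa using congrArg (bxor p) h), hcardV9]; norm_num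
    rw [hC] at hcard
    have : #((V₀.image (bxor p)).filter fun y' => Odd (e y' / 2)) ≤ 32 := hbad_le
    omega
  -- Reed–Muller (r = 2) on the bad coset: `≥ 128` odd points, or none — both absurd
  rcases ws_erm_round V₀ h0 hadd hcardV9 p (fun z => e z / 2) 2 (fun b hb a ha =>
      even_iff_two_dvd.1 ((tw_even_sum_iff univ (fun ε : Fin (2 + 1) → Bool =>
        e (fun j => b j ^^ decide (Odd #(univ.filter fun i => ε i && a i j))) / 2)).2 (heven3 b hb a ha))) with hev | hbig
  · exact (Int.not_even_iff_odd.2 hpodd) (hev p (mem_image.2 ⟨zeroVec, h0, bxor_zeroVec p⟩))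
  · norm_num at hbig
    omega

end Summit.QuantumAdvantage.QuantumAdvantage.Theorems.CubicForrelation.NearExactIsExact

end
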